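import Summits.QuantumFields.YangMills.Theorems.VirialFluxGapCentralFieldSeamDerivative
import Summits.QuantumFields.YangMills.Theorems.VirialFluxGapCentralFieldPlainDerivative
import Summits.QuantumFields.YangMills.Theorems.VirialFluxGapCentralFieldTraceBounds
import HarnessLib

/-!
# Route `VirialFluxGap` (YangMills): per-variable (E2) BUDGET of the explicit central field — wrap-block and seam variables contribute at most
# `3 − (3/2)/N + 3ρ²/N`, plain variables at most `3` (central chart C1 of ⟨stmt-QuantumFields-24141⟩; free-hands helper)

Width seat `ym-line-sfw-p2-w3` g59 (cell ym-idea-1, free hands), `--supports stmt-QuantumFields-24141`.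

Combines the exact per-variable traces (✓`centralDiv_wrap_eq`, ✓`centralDiv_seam_eq`, ✓`centralDiv_plain_le`) with the arithmetic ✓`central_trace_le`:
at a ring history `P` whose variable quaternion at the slot has `|Im q|² ≤ ρ²` and whose block average has `|z_B|² ≤ ρ²` (`ρ² ≤ ½`; both hold on the central
window), and under differentiability of the three coordinates (w2's `contDiff_centralCoeff`):
* ★★★ `centralDiv_wrap_le` — `Σ_a frameD (stdFrame ((i,(x,k)),a)) (coordinate a) (ringCoord P) ≤ 3 − (3/2)/N_k + 3ρ²/N_k`, `N_k = #wrapBlock k`;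
* ★★★ `centralDiv_seam_le` — the same at a seam variable with `N = L³`;
so that summing over the `6L⁴ + 1` variables of `X_fix` (each wrap block has `N_k` variables, the seam block `L³`) gives the divergence clause
`Σ_va ∂_va c²_va ≤ 3(6L⁴+1) − 4·(3/2) + 12ρ² = 18L⁴ − 3 + 12ρ²` (✓`budget_arith`; the sum itself is the assembler's bookkeeping over `FixVar L`).

HONEST LABEL: per-variable bounds; the sum over `FixVar L`, (E1) and the patching are NOT here; ⟨24141⟩ and ⟨22884⟩ stay OPEN; the Yang–Mills mass gap is NOT
proved by this; no summit is proved by a line.  THEOREMS ONLY (no `def`, no `sorry`).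

References: [cite: CosteEtAl1985].
-/

set_option autoImplicit false

noncomputable section

open scoped Matrix BigOperators Quaternion
open Literature.MathematicalPhysics.QuantumFieldTheory hiding SU2
open Literature.MathematicalPhysics.QuantumLattice

namespace Summit.QuantumFields.YangMills.Theorems.VirialFluxGap.CentralField

open Summit.QuantumFields.YangMills.Theorems.FemtoTransferGap
open Summit.QuantumFields.YangMills.Theorems.VirialFluxGap.RingDeficit
open Summit.QuantumFields.YangMills.Theorems.VirialFluxGap.FrameDerivative
open Summit.QuantumFields.YangMills.Theorems.VirialFluxGap.FrameHessian
open Summit.QuantumFields.YangMills.Theorems.VirialFluxGap.FixFrame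

variable {L : ℕ} [NeZero L]

/-- The components of a unit quaternion of `SU(2)`: `q₀² + |p|² = 1`. [folklore] -/
theorem su2Quat_components_sq (U : SU2) :
    (su2Quat U).re ^ 2 + ((su2Quat U).imI ^ 2 + (su2Quat U).imJ ^ 2 + (su2Quat U).imK ^ 2) = 1 := by
  have h1 : Quaternion.normSq (su2Quat U) = 1 := normSq_su2Quat U
  rw [Quaternion.normSq_def'] at h1
  nlinarith [h1]

/-- ★★★ **The (E2) budget of a wrap-block variable**: `Σ_a ∂_{(w,a)} c²_{(w,a)} ≤ 3 − (3/2)/N_k + 3ρ²/N_k` at `w = (i,(x,k))`, `x_k = −1`, when `|z_k|² ≤ ρ²`,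
`|Im q_w|² ≤ ρ²`, `ρ² < ½`, `σ_k = ±1`, and the coordinates are differentiable. [cite: CosteEtAl1985] -/
theorem centralDiv_wrap_le (σ : Fin 3 → ℝ) (σ₄ : ℝ) (P : (Fin (2 * L - 1 + 1) → GaugeConfig 3 L SU2) × (Site 3 L → SU2))
    (i : Fin (2 * L - 1 + 1)) {x : Site 3 L} {k : Fin 3} (hx : x k = -1) (hσ : σ k = 1 ∨ σ k = -1) {ρ : ℝ} (hρ : ρ ^ 2 < 1 / 2)
    (hz : (blockIm L (wrapBlock L k) k P 0) ^ 2 + (blockIm L (wrapBlock L k) k P 1) ^ 2 + (blockIm L (wrapBlock L k) k P 2) ^ 2 ≤ ρ ^ 2)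
    (hq : (su2Quat (P.1 i (x, k))).imI ^ 2 + (su2Quat (P.1 i (x, k))).imJ ^ 2 + (su2Quat (P.1 i (x, k))).imK ^ 2 ≤ ρ ^ 2)
    (hdiff : ∀ a : Fin 3, DifferentiableAt ℝ (fun M => pauliCoord (centralDir L σ σ₄ M (Sum.inl (i, (x, k)))) a) (ringCoord L P)) :
    frameD (stdFrame (Sum.inl (i, (x, k)), 0)) (fun M => pauliCoord (centralDir L σ σ₄ M (Sum.inl (i, (x, k)))) 0) (ringCoord L P) +
      frameD (stdFrame (Sum.inl (i, (x, k)), 1)) (fun M => pauliCoord (centralDir L σ σ₄ M (Sum.inl (i, (x, k)))) 1) (ringCoord L P) +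
      frameD (stdFrame (Sum.inl (i, (x, k)), 2)) (fun M => pauliCoord (centralDir L σ σ₄ M (Sum.inl (i, (x, k)))) 2) (ringCoord L P) ≤
    3 - (3 / 2) / ((wrapBlock L k).card : ℝ) + 3 * ρ ^ 2 / ((wrapBlock L k).card : ℝ) := by
  have hlt : (blockIm L (wrapBlock L k) k P 0) ^ 2 + (blockIm L (wrapBlock L k) k P 1) ^ 2 + (blockIm L (wrapBlock L k) k P 2) ^ 2 < 1 / 2 :=
    lt_of_le_of_lt hz hρ
  have hN : (0 : ℝ) < ((wrapBlock L k).card : ℝ) := by exact_mod_cast (wrapBlock_nonempty (L := L) k).card_pos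
  rw [centralDiv_wrap_eq σ σ₄ P i hx hlt hdiff]
  have h := central_trace_le (N := ((wrapBlock L k).card : ℝ)) (z := blockIm L (wrapBlock L k) k P)
    (p := ![(su2Quat (P.1 i (x, k))).imI, (su2Quat (P.1 i (x, k))).imJ, (su2Quat (P.1 i (x, k))).imK])
    hσ (by simpa using su2Quat_components_sq (P.1 i (x, k))) (by simpa using hq) hz hρ.le hN
  simpa using h

/-- ★★★ **The (E2) budget of a seam variable**: `Σ_a ∂_{(x,a)} c²_{(x,a)} ≤ 3 − (3/2)/L³ + 3ρ²/L³` when `|z₄|² ≤ ρ²`, `|Im q(P.2 x)|² ≤ ρ²`, `ρ² < ½`, `σ₄ = ±1`,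
and the coordinates are differentiable. [cite: CosteEtAl1985] -/
theorem centralDiv_seam_le (σ : Fin 3 → ℝ) {σ₄ : ℝ} (hσ₄ : σ₄ = 1 ∨ σ₄ = -1) (P : (Fin (2 * L - 1 + 1) → GaugeConfig 3 L SU2) × (Site 3 L → SU2))
    (x : Site 3 L) {ρ : ℝ} (hρ : ρ ^ 2 < 1 / 2)
    (hz : (seamIm L P 0) ^ 2 + (seamIm L P 1) ^ 2 + (seamIm L P 2) ^ 2 ≤ ρ ^ 2)
    (hq : (su2Quat (P.2 x)).imI ^ 2 + (su2Quat (P.2 x)).imJ ^ 2 + (su2Quat (P.2 x)).imK ^ 2 ≤ ρ ^ 2)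
    (hdiff : ∀ a : Fin 3, DifferentiableAt ℝ (fun M => pauliCoord (centralDir L σ σ₄ M (Sum.inr x)) a) (ringCoord L P)) :
    frameD (stdFrame (Sum.inr x, 0)) (fun M => pauliCoord (centralDir L σ σ₄ M (Sum.inr x)) 0) (ringCoord L P) +
      frameD (stdFrame (Sum.inr x, 1)) (fun M => pauliCoord (centralDir L σ σ₄ M (Sum.inr x)) 1) (ringCoord L P) +
      frameD (stdFrame (Sum.inr x, 2)) (fun M => pauliCoord (centralDir L σ σ₄ M (Sum.inr x)) 2) (ringCoord L P) ≤
    3 - (3 / 2) / ((L : ℝ) ^ 3) + 3 * ρ ^ 2 / ((L : ℝ) ^ 3) := by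
  have hlt : (seamIm L P 0) ^ 2 + (seamIm L P 1) ^ 2 + (seamIm L P 2) ^ 2 < 1 / 2 := lt_of_le_of_lt hz hρ
  have hL : (0 : ℝ) < (L : ℝ) := by exact_mod_cast NeZero.pos L
  have hN : (0 : ℝ) < (L : ℝ) ^ 3 := by positivity
  rw [centralDiv_seam_eq σ σ₄ P x hlt hdiff]
  have h := central_trace_le (N := (L : ℝ) ^ 3) (z := seamIm L P)
    (p := ![(su2Quat (P.2 x)).imI, (su2Quat (P.2 x)).imJ, (su2Quat (P.2 x)).imK])
    hσ₄ (by simpa using su2Quat_components_sq (P.2 x)) (by simpa using hq) hz hρ.le hN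
  simpa using h

end Summit.QuantumFields.YangMills.Theorems.VirialFluxGap.CentralField

end
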